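import Summits.AtomisticToContinuum.Crystallization.Theorems.PalmUnimodularRigidityMinimiserShellsResidualDefs
import Summits.AtomisticToContinuum.Crystallization.Theorems.PalmUnimodularRigidityMinimiserShellsGoodShellMeasurable
import Summits.AtomisticToContinuum.Crystallization.Theorems.PalmUnimodularRigidityMinimiserShellsDeepBadPricingOfShellNoBoundary
import Literature.Geometry.DiscreteGeometry.KissingPatterns
import Mathlib.Topology.Compactness.Compact
import Mathlib.Data.Fintype.Pigeonhole
import Mathlib.Order.Interval.Finset.Nat

/-!
# The boundary lemma of crux `MinimiserShells` — helpers (stub `stub_boundaryShell`, line `elastic-coarse-to-fine` r5)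

Crux item stmt-AtomisticToContinuum-9225, route `PalmUnimodularRigidity`, crux decl
`Summit.AtomisticToContinuum.Crystallization.Theses.PalmUnimodularRigidity.MinimiserShells`; skeleton r5
(`Cruxes/MinimiserShells/Lines/elastic_coarse_to_fine.lean`, lead `…-c15`).  This file carries the helpers of the
boundary lemma `BoundaryShell.stub_boundaryShell` (file `…BoundaryShell.lean`): if the root shell of a hard-core
configuration passes every LOOSENED shell test and every atom's shell passes the `1/100`-loosened test, the root shell
is good in the crux's EXACT sense.  No energy enters; everything is geometry of the two kissing patterns plus
compactness of `[9/10, 1] × Iso(ℝ³)`.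

* `exists_enum`, `exists_tuple_of_shellCloseTo`, `shellCloseTo_of_tuple` — `ShellCloseTo` (a bijection moving points by
  `≤ η` after a linear isometry) discretised as an injective 12-tuple matched to an enumerated pattern.
* `exists_scale_of_looseGoodShell` — atoms of a `θ`-loosely good shell of scale `b` have `|‖w‖ − b| ≤ b/100 + θ`.
* `dist_le_of_covering`, `no_sphere_atom` — EXCLUSION OF THE SPHERE: granted the `45°` covering property of a pattern, an
  atom `k` with `‖k‖ = 5a/4` exactly is within `0.9a + a/100` of a matched atom `y`
  (`‖k − a·A p‖² = (41/16)a² − 2a⟪k, A p⟫ ≤ (81/100)a²`), while the `1/100`-loosely good shell of `y` (atoms `−y` and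
  `k − y`) forces `‖k − y‖ ≥ 0.99·b − 1/100 ≥ 0.948a` — impossible.
* `shell_of_limit_data` — hence a 12-tuple matched within `a/100`, with every other nonzero atom of the window at norm
  `≥ 5a/4`, IS the exact shell.
* `exists_limit_param` — COMPACTNESS: admissible `(a, L)` at the levels `θ n ↓ 0` form a decreasing sequence of closed
  sets meeting the compact `[9/10, 1] × Iso`; Cantor's intersection theorem gives a common parameter, i.e. the level-`0`
  conditions.
-/

noncomputable section

open MeasureTheory Filter Topology
open scoped ENNReal BigOperators Classical

namespace Summit.AtomisticToContinuum.Crystallization.Theorems.PalmUnimodularRigidityMinimiserShells.BoundaryShell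

open Literature.Probability.Process (IsRootedHardCore count_restrict_singleton_ne_zero_iff)
open Literature.MathematicalPhysics.StatisticalMechanics (UniformlyDiscrete)
open Literature.Geometry.DiscreteGeometry (ShellCloseTo EtaMatched fccKissingPattern hcpKissingPattern
  card_fccKissingPattern card_hcpKissingPattern norm_eq_one_of_mem_fccKissingPattern norm_eq_one_of_mem_hcpKissingPattern)
open Summit.AtomisticToContinuum.Crystallization.Theorems.MinimiserShells.Negative.LoadBearing (GoodShell)
open Summit.AtomisticToContinuum.Crystallization.Theorems.MinimiserShells.Negative.Rootedness (E3)
open Summit.AtomisticToContinuum.Crystallization.Theorems.PalmUnimodularRigidityMinimiserShells.Residual (LooseGoodShell)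
open Summit.AtomisticToContinuum.Crystallization.Theorems.PalmUnimodularRigidityMinimiserShells.GoodShellMeasurable
  (etaMatched_of_param isCompact_iso)
open Summit.AtomisticToContinuum.Crystallization.Theorems.PalmUnimodularRigidityMinimiserShells.ShellNoBoundary
  (count_restrict_image_sub_singleton_ne_zero_iff)

/-! ## Enumerated patterns and tuples -/

/-- A twelve-point pattern has an injective enumeration by `Fin 12`. -/
theorem exists_enum {P : Finset E3} (hP : P.card = 12) :
    ∃ q : Fin 12 → E3, Function.Injective q ∧ (∀ i, q i ∈ P) ∧ ∀ p ∈ P, ∃ i, q i = p := by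
  have hc : Fintype.card ↥P = 12 := by rw [Fintype.card_coe, hP]
  let e : ↥P ≃ Fin 12 := Fintype.equivFinOfCardEq hc
  refine ⟨fun i => (e.symm i : E3), fun i j h => e.symm.injective (Subtype.ext h), fun i => (e.symm i).2,
    fun p hp => ⟨e ⟨p, hp⟩, by simp only [Equiv.symm_apply_apply]⟩⟩

/-- The norm of a rotated, scaled unit vector: `‖A (a • p)‖ = a` for `a ≥ 0`, `‖p‖ = 1`. -/
theorem norm_map_smul {A : E3 →ₗᵢ[ℝ] E3} {a : ℝ} (ha : 0 ≤ a) {p : E3} (hp : ‖p‖ = 1) : ‖A (a • p)‖ = a := by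
  rw [A.norm_map, norm_smul, hp, mul_one, Real.norm_of_nonneg ha]

/-- A point `η`-close to a rotated, scaled unit vector has norm within `η` of the scale. -/
theorem abs_norm_sub_le {A : E3 →ₗᵢ[ℝ] E3} {a η : ℝ} (ha : 0 ≤ a) {p w : E3} (hp : ‖p‖ = 1)
    (h : dist w (A (a • p)) ≤ η) : |‖w‖ - a| ≤ η := by
  rw [← norm_map_smul (A := A) ha hp]
  exact (abs_norm_sub_norm_le w (A (a • p))).trans (by rwa [← dist_eq_norm])

/-- **Discretisation of `ShellCloseTo`.**  If the shell `T` is `η`-close to the `a`-scaled pattern `P` (`a ≠ 0`),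
enumerated by `q`, then some linear isometry `A` and some injective 12-tuple `t` exhausting `T` satisfy
`dist (t i) (A (a • q i)) ≤ η`. -/
theorem exists_tuple_of_shellCloseTo {T P : Finset E3} {q : Fin 12 → E3} (hq : Function.Injective q)
    (hqP : ∀ i, q i ∈ P) (hPq : ∀ p ∈ P, ∃ i, q i = p) {a η : ℝ} (ha : a ≠ 0)
    (h : ShellCloseTo η T (Finset.image (fun v : E3 => a • v) P)) :
    ∃ (A : E3 →ₗᵢ[ℝ] E3) (t : Fin 12 → E3), Function.Injective t ∧ (∀ i, t i ∈ T) ∧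
      (∀ w ∈ T, ∃ i, t i = w) ∧ ∀ i, dist (t i) (A (a • q i)) ≤ η := by
  obtain ⟨A, e, he⟩ := h
  have hmem : ∀ i, A (a • q i) ∈ Finset.image (⇑A) (Finset.image (fun v : E3 => a • v) P) :=
    fun i => Finset.mem_image_of_mem _ (Finset.mem_image_of_mem _ (hqP i))
  refine ⟨A, fun i => (e.symm ⟨A (a • q i), hmem i⟩ : E3), ?_, fun i => (e.symm _).2, ?_, ?_⟩
  · intro i j hij
    have h1 : e.symm ⟨A (a • q i), hmem i⟩ = e.symm ⟨A (a • q j), hmem j⟩ := Subtype.ext hij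
    have h2 := congrArg Subtype.val (e.symm.injective h1)
    exact hq (smul_right_injective E3 ha (A.injective h2))
  · intro w hw
    obtain ⟨u, hu, hu'⟩ := Finset.mem_image.1 (e ⟨w, hw⟩).2
    obtain ⟨v, hv, rfl⟩ := Finset.mem_image.1 hu
    obtain ⟨i, rfl⟩ := hPq v hv
    refine ⟨i, ?_⟩
    have h3 : (⟨A (a • q i), hmem i⟩ : ↥(Finset.image (⇑A) (Finset.image (fun v : E3 => a • v) P))) =
        e ⟨w, hw⟩ := Subtype.ext hu'
    show (e.symm ⟨A (a • q i), hmem i⟩ : E3) = w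
    rw [h3, Equiv.symm_apply_apply]
  · intro i
    have h4 := he (e.symm ⟨A (a • q i), hmem i⟩)
    rwa [Equiv.apply_symm_apply] at h4

/-- **Converse**: an injective 12-tuple `t` with `dist (t i) (A (a • q i)) ≤ η` (`q` enumerating `P`, `a ≠ 0`) makes
its range `η`-close to the `a`-scaled pattern. -/
theorem shellCloseTo_of_tuple {P : Finset E3} {q : Fin 12 → E3} (hq : Function.Injective q)
    (hqP : ∀ i, q i ∈ P) (hPq : ∀ p ∈ P, ∃ i, q i = p) {a η : ℝ} (ha : a ≠ 0) (A : E3 →ₗᵢ[ℝ] E3)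
    {t : Fin 12 → E3} (ht : Function.Injective t) (hd : ∀ i, dist (t i) (A (a • q i)) ≤ η) :
    ShellCloseTo η (Finset.univ.image t) (Finset.image (fun v : E3 => a • v) P) := by
  refine ⟨A, etaMatched_of_param (ι := Fin 12) (f₁ := t) (f₂ := fun i => A (a • q i))
    (fun i => Finset.mem_image_of_mem _ (Finset.mem_univ i)) ht (fun w hw => by simpa using hw)
    (fun i => Finset.mem_image_of_mem _ (Finset.mem_image_of_mem _ (hqP i)))
    (fun i j h => hq (smul_right_injective E3 ha (A.injective h))) (fun w hw => ?_) hd⟩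
  obtain ⟨u, hu, rfl⟩ := Finset.mem_image.1 hw
  obtain ⟨v, hv, rfl⟩ := Finset.mem_image.1 hu
  obtain ⟨i, rfl⟩ := hPq v hv
  exact ⟨i, rfl⟩

/-! ## Reading a loosely good shell: norms of its atoms -/

/-- **Atoms of a loosely good shell have norm close to its scale.**  If the shell of `y` read in `count|(S − y)` is
`θ`-loosely good, there is a scale `b ∈ [9/10, 1]` such that every atom `w ≠ 0` (`w + y ∈ S`) with
`‖w‖ ≤ (5/4 − θ)·b` has `|‖w‖ − b| ≤ b/100 + θ`. -/
theorem exists_scale_of_looseGoodShell {θ : ℝ} {S : Set E3} {y : E3}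
    (h : LooseGoodShell θ ((Measure.count : Measure E3).restrict ((fun z => z - y) '' S))) :
    ∃ b : ℝ, 9 / 10 ≤ b ∧ b ≤ 1 ∧ ∀ w : E3, w + y ∈ S → w ≠ 0 → ‖w‖ ≤ (5 / 4 - θ) * b →
      |‖w‖ - b| ≤ b / 100 + θ := by
  obtain ⟨b, hb1, hb2, T, hT, hclose⟩ := h
  refine ⟨b, hb1, hb2, fun w hwS hw0 hwle => ?_⟩
  have hwT : w ∈ T := by
    rw [← Finset.mem_coe, hT]
    exact ⟨(count_restrict_image_sub_singleton_ne_zero_iff S y w).2 hwS, hw0, hwle⟩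
  have hb0 : (0 : ℝ) ≤ b := by linarith
  have key : ∀ {P : Finset E3}, (∀ p ∈ P, ‖p‖ = 1) →
      ShellCloseTo (b / 100 + θ) T (Finset.image (fun v : E3 => b • v) P) → |‖w‖ - b| ≤ b / 100 + θ := by
    intro P hP hc
    obtain ⟨A, e, he⟩ := hc
    obtain ⟨u, hu, hu'⟩ := Finset.mem_image.1 (e ⟨w, hwT⟩).2
    obtain ⟨v, hv, rfl⟩ := Finset.mem_image.1 hu
    have hdist : dist w (A (b • v)) ≤ b / 100 + θ := by
      have h1 := he ⟨w, hwT⟩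
      rwa [← hu'] at h1
    exact abs_norm_sub_le hb0 (hP v hv) hdist
  rcases hclose with hc | hc
  · exact key (fun p hp => norm_eq_one_of_mem_fccKissingPattern hp) hc
  · exact key (fun p hp => norm_eq_one_of_mem_hcpKissingPattern hp) hc

/-! ## Exclusion of an atom on the sphere `‖k‖ = 5a/4` -/

/-- **A point of the sphere `‖k‖ = 5a/4` within `45°` of the rotated pattern direction `A p` is within `0.9·a` of the
scaled pattern point `A (a • p)`**: `‖k − a·A p‖² = (41/16)a² − 2a⟪k, A p⟫ ≤ (81/100)a²` as `⟪k, A p⟫ ≥ (5a/4)/√2`. -/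
theorem dist_le_of_covering {A : E3 →ₗᵢ[ℝ] E3} {a : ℝ} (ha : 0 < a) {k p : E3} (hp : ‖p‖ = 1)
    (hk : ‖k‖ = 5 / 4 * a) (hcov : ‖k‖ ^ 2 ≤ 2 * (inner ℝ k (A p)) ^ 2) (hpos : 0 ≤ inner ℝ k (A p)) :
    dist k (A (a • p)) ≤ 9 / 10 * a := by
  set s := inner ℝ k (A p) with hs
  have hAp : ‖A p‖ = 1 := by rw [A.norm_map, hp]
  have hsq : dist k (A (a • p)) ^ 2 = (5 / 4 * a) ^ 2 - 2 * a * s + a ^ 2 := by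
    rw [dist_eq_norm, A.map_smul, norm_sub_sq_real, real_inner_smul_right, norm_smul, hAp, mul_one,
      Real.norm_of_nonneg ha.le, hk]
    ring
  rw [hk] at hcov
  have hd0 : 0 ≤ dist k (A (a • p)) := dist_nonneg
  have hd2 : dist k (A (a • p)) ^ 2 ≤ (9 / 10 * a) ^ 2 := by
    rw [hsq]
    nlinarith [sq_nonneg (s + 701 / 800 * a), sq_nonneg (s - 701 / 800 * a), mul_pos ha ha]
  nlinarith [hd2, hd0, ha]

/-- **No atom on the sphere `‖k‖ = 5a/4`.**  Let `t` be a 12-tuple of atoms of `S ∋ 0`, `a/100`-matched to the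
rotated `a`-scaled pattern `A (a • q i)` (`q` enumerating a pattern `P` of unit vectors with the covering property for
`A`), and let every atom `y ∈ S` have a `1/100`-loosely good shell.  Then no atom `k ∈ S` has `‖k‖ = 5a/4`: such a `k`
would be within `0.91a` of some `t i`, while the shell of `y = t i` (scale `b`, atoms `−t i` and `k − t i`) forces
`‖k − t i‖ ≥ 0.99b − 1/100 ≥ 0.948a`. -/
theorem no_sphere_atom {S : Set E3} (h0 : (0 : E3) ∈ S) {a : ℝ} (ha1 : 9 / 10 ≤ a) (ha2 : a ≤ 1)
    {A : E3 →ₗᵢ[ℝ] E3} {P : Finset E3} (hP1 : ∀ p ∈ P, ‖p‖ = 1) {q : Fin 12 → E3}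
    (hqP : ∀ i, q i ∈ P) (hPq : ∀ p ∈ P, ∃ i, q i = p)
    {t : Fin 12 → E3} (htS : ∀ i, t i ∈ S) (hd : ∀ i, dist (t i) (A (a • q i)) ≤ a / 100)
    (hnb : ∀ y ∈ S, LooseGoodShell (1 / 100) ((Measure.count : Measure E3).restrict ((fun z => z - y) '' S)))
    (hcov : ∀ u : E3, ∃ p ∈ P, ‖u‖ ^ 2 ≤ 2 * (inner ℝ u (A p)) ^ 2 ∧ 0 ≤ inner ℝ u (A p))
    {k : E3} (hkS : k ∈ S) (hk : ‖k‖ = 5 / 4 * a) : False := by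
  have ha0 : 0 < a := by linarith
  obtain ⟨p, hp, hc1, hc2⟩ := hcov k
  obtain ⟨i, rfl⟩ := hPq p hp
  -- `k` is within `0.91 a` of the atom `t i`
  have h1 : dist k (A (a • q i)) ≤ 9 / 10 * a := dist_le_of_covering ha0 (hP1 _ (hqP i)) hk hc1 hc2
  have h2 : dist k (t i) ≤ 91 / 100 * a := by
    have := dist_triangle k (A (a • q i)) (t i)
    rw [dist_comm (A (a • q i)) (t i)] at this
    linarith [hd i]
  -- norms of `t i`
  have hti : |‖t i‖ - a| ≤ a / 100 := abs_norm_sub_le ha0.le (hP1 _ (hqP i)) (hd i)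
  obtain ⟨hti1, hti2⟩ := abs_le.1 hti
  have hti0 : t i ≠ 0 := by
    intro h
    rw [h, norm_zero] at hti1
    linarith
  -- the shell of `y = t i`
  obtain ⟨b, hb1, hb2, hb⟩ := exists_scale_of_looseGoodShell (hnb (t i) (htS i))
  -- atom `-t i`
  have hw1 : |‖-t i‖ - b| ≤ b / 100 + 1 / 100 := by
    refine hb (-t i) (by rwa [neg_add_cancel]) (neg_ne_zero.2 hti0) ?_
    rw [norm_neg]
    linarith
  rw [norm_neg] at hw1
  obtain ⟨hw1a, hw1b⟩ := abs_le.1 hw1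
  -- atom `k - t i`
  have hkt0 : k - t i ≠ 0 := by
    intro h
    rw [sub_eq_zero] at h
    rw [h] at hk
    linarith
  have hw2 : |‖k - t i‖ - b| ≤ b / 100 + 1 / 100 := by
    refine hb (k - t i) (by rwa [sub_add_cancel]) hkt0 ?_
    rw [← dist_eq_norm]
    linarith
  rw [← dist_eq_norm] at hw2
  obtain ⟨hw2a, hw2b⟩ := abs_le.1 hw2
  linarith

/-- **The exact shell from limit data (one pattern).**  If the 12-tuple `t` of nonzero atoms of `S ∋ 0` is
`a/100`-matched to `A (a • q i)`, every OTHER nonzero atom of the window `‖w‖ ≤ 5/4` has `‖w‖ ≥ 5a/4`, every atom has a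
`1/100`-loosely good shell and the pattern has the covering property for `A`, then the atoms of the closed ball
`‖w‖ ≤ 5a/4` are exactly the `t i` (the sphere is empty by `no_sphere_atom`) and the shell is `a/100`-close to the
`a`-scaled pattern. -/
theorem shell_of_limit_data {S : Set E3} (h0 : (0 : E3) ∈ S) {a : ℝ} (ha1 : 9 / 10 ≤ a) (ha2 : a ≤ 1)
    {A : E3 →ₗᵢ[ℝ] E3} {P : Finset E3} (hP1 : ∀ p ∈ P, ‖p‖ = 1) {q : Fin 12 → E3} (hq : Function.Injective q)
    (hqP : ∀ i, q i ∈ P) (hPq : ∀ p ∈ P, ∃ i, q i = p)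
    {t : Fin 12 → E3} (ht : Function.Injective t) (htS : ∀ i, t i ∈ S) (ht0 : ∀ i, t i ≠ 0)
    (hd : ∀ i, dist (t i) (A (a • q i)) ≤ a / 100)
    (hout : ∀ w ∈ S, w ≠ 0 → ‖w‖ ≤ 5 / 4 → (∀ i, t i ≠ w) → 5 / 4 * a ≤ ‖w‖)
    (hnb : ∀ y ∈ S, LooseGoodShell (1 / 100) ((Measure.count : Measure E3).restrict ((fun z => z - y) '' S)))
    (hcov : ∀ u : E3, ∃ p ∈ P, ‖u‖ ^ 2 ≤ 2 * (inner ℝ u (A p)) ^ 2 ∧ 0 ≤ inner ℝ u (A p)) :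
    ∃ T : Finset E3, (↑T : Set E3) =
        {w : E3 | ((Measure.count : Measure E3).restrict S) {w} ≠ 0 ∧ w ≠ 0 ∧ ‖w‖ ≤ 5 / 4 * a} ∧
      ShellCloseTo (a / 100) T (Finset.image (fun v : E3 => a • v) P) := by
  have ha0 : 0 < a := by linarith
  refine ⟨Finset.univ.image t, ?_, shellCloseTo_of_tuple hq hqP hPq ha0.ne' A ht hd⟩
  ext w
  simp only [Finset.coe_image, Finset.coe_univ, Set.image_univ, Set.mem_range, Set.mem_setOf_eq,
    count_restrict_singleton_ne_zero_iff]
  constructor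
  · rintro ⟨i, rfl⟩
    refine ⟨htS i, ht0 i, ?_⟩
    have h := (abs_le.1 (abs_norm_sub_le ha0.le (hP1 _ (hqP i)) (hd i))).2
    linarith
  · rintro ⟨hwS, hw0, hwle⟩
    by_contra hnot
    push Not at hnot
    have h5 : 5 / 4 * a ≤ ‖w‖ := hout w hwS hw0 (by linarith) hnot
    exact no_sphere_atom h0 ha1 ha2 hP1 hqP hPq htS hd hnb hcov hwS (le_antisymm hwle h5)

/-! ## Compactness: a common parameter for all levels -/

/-- **Cantor intersection for the matching parameters.**  Fix a 12-tuple `t`, an enumeration `q` and a finite window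
`F`.  If for arbitrarily large `n` some `(a, L) ∈ [9/10, 1] × Iso(ℝ³)` matches `t` to `L (a • q ·)` within
`a/100 + θ n` and keeps every other nonzero point of `F` at norm `≥ (5/4 − θ n)·a`, where `θ` is antitone and tends to
`0`, then some `(a, A)` does both with `θ` replaced by `0` (the admissible sets are closed, decreasing and meet the
compact `[9/10, 1] × Iso`). -/
theorem exists_limit_param (F : Finset E3) (q t : Fin 12 → E3) (θ : ℕ → ℝ) (hθ0 : ∀ n, 0 ≤ θ n)
    (hθanti : ∀ n, θ (n + 1) ≤ θ n) (hθsmall : ∀ ε : ℝ, 0 < ε → ∃ n, θ n < ε)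
    (hfreq : ∀ m : ℕ, ∃ n, m ≤ n ∧ ∃ a : ℝ, 9 / 10 ≤ a ∧ a ≤ 1 ∧ ∃ L : E3 →L[ℝ] E3, (∀ v, ‖L v‖ = ‖v‖) ∧
      (∀ i, dist (t i) (L (a • q i)) ≤ a / 100 + θ n) ∧
      ∀ w ∈ F, w ≠ 0 → (∀ i, t i ≠ w) → (5 / 4 - θ n) * a ≤ ‖w‖) :
    ∃ a : ℝ, 9 / 10 ≤ a ∧ a ≤ 1 ∧ ∃ A : E3 →ₗᵢ[ℝ] E3, (∀ i, dist (t i) (A (a • q i)) ≤ a / 100) ∧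
      ∀ w ∈ F, w ≠ 0 → (∀ i, t i ≠ w) → 5 / 4 * a ≤ ‖w‖ := by
  -- the compact parameter set and the admissible sets
  set K : Set (ℝ × (E3 →L[ℝ] E3)) := Set.Icc (9 / 10 : ℝ) 1 ×ˢ {L : E3 →L[ℝ] E3 | ∀ v, ‖L v‖ = ‖v‖} with hK
  have hKc : IsCompact K := isCompact_Icc.prod isCompact_iso
  set D : ℕ → Set (ℝ × (E3 →L[ℝ] E3)) := fun n =>
    {r | (∀ i, dist (t i) (r.2 (r.1 • q i)) ≤ r.1 / 100 + θ n) ∧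
      ∀ w : {w : ↥F // (w : E3) ≠ 0 ∧ ∀ i, t i ≠ (w : E3)}, (5 / 4 - θ n) * r.1 ≤ ‖((w : ↥F) : E3)‖} with hD
  have hDclosed : ∀ n, IsClosed (D n) := by
    intro n
    simp only [hD, Set.setOf_and, Set.setOf_forall]
    refine (isClosed_iInter fun i => isClosed_le ?_ ?_).inter (isClosed_iInter fun w => isClosed_le ?_ ?_)
    all_goals fun_prop
  set C : ℕ → Set (ℝ × (E3 →L[ℝ] E3)) := fun n => K ∩ D n with hC
  have hCclosed : ∀ n, IsClosed (C n) := fun n => hKc.isClosed.inter (hDclosed n)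
  have hCanti : ∀ n, C (n + 1) ⊆ C n := by
    rintro n ⟨a, L⟩ ⟨hK', hd, hw⟩
    have ha0 : 0 ≤ a := by
      have h := (Set.mem_prod.1 hK').1
      exact le_trans (by norm_num) h.1
    refine ⟨hK', fun i => (hd i).trans (by linarith [hθanti n]), fun w => le_trans ?_ (hw w)⟩
    have := hθanti n
    nlinarith
  have hmono : Antitone C := antitone_nat_of_succ_le hCanti
  have hCne : ∀ n, (C n).Nonempty := by
    intro m
    obtain ⟨n, hmn, a, ha1, ha2, L, hL, hd, hw⟩ := hfreq m
    refine ⟨(a, L), hmono hmn ⟨Set.mem_prod.2 ⟨⟨ha1, ha2⟩, hL⟩, hd, fun w => hw _ w.1.2 w.2.1 w.2.2⟩⟩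
  have hC0 : IsCompact (C 0) := hKc.inter_right (hDclosed 0)
  obtain ⟨⟨a, L⟩, hr⟩ :=
    IsCompact.nonempty_iInter_of_sequence_nonempty_isCompact_isClosed C hCanti hCne hC0 hCclosed
  rw [Set.mem_iInter] at hr
  obtain ⟨⟨ha1, ha2⟩, hL⟩ := Set.mem_prod.1 (hr 0).1
  set A : E3 →ₗᵢ[ℝ] E3 := ⟨(L : E3 →ₗ[ℝ] E3), hL⟩ with hA
  have hAe : ∀ v : E3, A v = L v := fun v => rfl
  refine ⟨a, ha1, ha2, A, fun i => ?_, fun w hw hw0 hne => ?_⟩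
  · refine le_of_forall_pos_lt_add fun ε hε => ?_
    obtain ⟨n, hn⟩ := hθsmall ε hε
    have h := (hr n).2.1 i
    rw [hAe]
    linarith
  · refine le_of_forall_pos_lt_add fun ε hε => ?_
    obtain ⟨n, hn⟩ := hθsmall ε hε
    have h := (hr n).2.2 ⟨⟨w, hw⟩, hw0, hne⟩
    have h' : θ n * a ≤ θ n := by nlinarith [hθ0 n]
    simp only at h
    nlinarith


/-! ## Registered part -/

/-- **Registered part 1 of stub `stub_boundaryShell` (`stub_boundaryShell_part01`): NO ATOM ON THE SPHERE `‖k‖ = 5a/4`**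
(closed form of `no_sphere_atom`).  For `S ∋ 0`, a scale `a ∈ [9/10, 1]`, an isometry `A`, a pattern `P` of unit vectors enumerated
by `q` with the `45°` covering property for `A`, and a 12-tuple `t` of atoms `a/100`-matched to `A (a • q i)`: if every atom of `S` has
a `1/100`-loosely good shell, then no atom of `S` has norm exactly `5a/4`. -/
theorem stub_boundaryShell_part01 : ∀ S : Set E3, (0 : E3) ∈ S → ∀ a : ℝ, 9 / 10 ≤ a → a ≤ 1 → ∀ (A : E3 →ₗᵢ[ℝ] E3) (P : Finset E3), (∀ p ∈ P, ‖p‖ = 1) → ∀ q : Fin 12 → E3, (∀ i, q i ∈ P) → (∀ p ∈ P, ∃ i, q i = p) → ∀ t : Fin 12 → E3, (∀ i, t i ∈ S) → (∀ i, dist (t i) (A (a • q i)) ≤ a / 100) → (∀ y ∈ S, LooseGoodShell (1 / 100) ((Measure.count : Measure E3).restrict ((fun z => z - y) '' S))) → (∀ u : E3, ∃ p ∈ P, ‖u‖ ^ 2 ≤ 2 * (inner ℝ u (A p)) ^ 2 ∧ 0 ≤ inner ℝ u (A p)) → ∀ k ∈ S, ‖k‖ ≠ 5 / 4 * a :=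
  fun _ h0 _ ha1 ha2 _ _ hP1 _ hqP hPq _ htS hd hnb hcov _ hkS hk =>
    no_sphere_atom h0 ha1 ha2 hP1 hqP hPq htS hd hnb hcov hkS hk

end Summit.AtomisticToContinuum.Crystallization.Theorems.PalmUnimodularRigidityMinimiserShells.BoundaryShell

end
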